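import Literature.NumberTheory.Automorphic.QuaternionLocalUnitDensity
import Literature.NumberTheory.Automorphic.QuaternionLocalMaximal
import Literature.NumberTheory.Automorphic.EichlerOrderPadicSplitting
import Literature.NumberTheory.Automorphic.QuaternionAlgebraClassification
import Literature.NumberTheory.Automorphic.BrandtModuleDictionary
import Literature.NumberTheory.Automorphic.MaximalOrderRamifiedPrime
import Mathlib.LinearAlgebra.Matrix.Charpoly.Coeff
import Mathlib.Analysis.Normed.Group.Ultra
import HarnessLib

/-!
# The maximal orders at a split prime: `O₁,₍ₚ₎ = Φ⁻¹(M₂(ℤ_p))` for a matrix model `Φ`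
# (Vignéras, LNM 800, Ch. II §2 Lemme 2.1, Thm. 2.3; Ch. III §5 Prop. 5.1)

Topic `NumberTheory/Automorphic`; one small definition (`AlgHom.conjUnit`, conjugate of an
algebra map into a matrix algebra by an invertible matrix), otherwise theorems; no named fact,
no instance. Local model, at a prime `p` where the definite quaternion algebra `B` over `ℚ`
is *split* (`ℚ_p ⊗ B ≅ M₂(ℚ_p)`), of the maximal `ℤ`-orders of `B`, in the language of the
localisations `O₍ₚ₎ = localAt p O ⊆ B`: for every `ℚ`-algebra map `φ : B → M₂(ℚ_p)` and every
maximal `ℤ`-order `O₁` there is `g ∈ GL₂(ℚ_p)` with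

  `O₁,₍ₚ₎ = {x ∈ B | g⁻¹ φ(x) g ∈ M₂(ℤ_p)}`   (`IsMaximalZOrder.exists_conjUnit_localAt_iff`).

Vignéras II §2 (`K` local, `H = M₂(K) = End(V)`): **Lemme 2.1** (1) "les ordres maximaux de
`End(V)` sont les anneaux `End(L)`", **Thm. 2.3** (1) "les ordres maximaux de `M(2,K)` sont
conjugués à `M(2,R)`"; the passage from the completion to the localisation of a *global*
maximal order is III §5 Prop. 5.1 (the patching principle of `QuaternionLocalMaximal.lean`),
and the conjugating matrix is the tree's `exists_isUnit_conj_integral`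
(`EichlerOrderPadicSplitting.lean`). Unlike the abstract reduction maps `ψ` of
`exists_modPow_reduction` there, the model `Φ = g⁻¹ φ g` is an honest algebra map
`B →ₐ[ℚ] M₂(ℚ_p)`, so that norms and traces are visible:

* `AlgHom.det_eq_reducedNorm`, `AlgHom.trace_eq_reducedTrace` — **`det Φ(x) = nrd x`,
  `tr Φ(x) = trd x`** for *any* `ℚ`-algebra map `B → M₂(K)` (Cayley–Hamilton against the
  reduced characteristic polynomial; a non-scalar `2 × 2` matrix has a unique monic quadratic
  annihilator, and scalars come from the centre `ℚ` of `B`).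
* `AlgHom.exists_norm_sub_le` — **density**: `Φ(B)` is dense in `M₂(ℚ_p)` (the induced
  `ℚ_p ⊗ B → M₂(ℚ_p)` is injective by simplicity, bijective by dimension; approximate `p`-adic
  coordinates by rationals).
* `IsMaximalZOrder.exists_conjUnit_localAt_iff` — **Lemme 2.1 / Thm. 2.3 + Prop. 5.1** as
  displayed above.
* `forall_not_dvd_den_reducedTrace_iff_of_split` — **self-duality of `O₍ₚ₎` at a split
  prime**: `x ∈ O₍ₚ₎ ↔ trd(x y) ∈ ℤ₍ₚ₎` for all `y ∈ O₍ₚ₎` (the dual of `M₂(ℤ_p)` under the trace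
  form is `M₂(ℤ_p)`: Vignéras II §2 / I §4 Lemme 4.7, `d(M(2,R)) = R`), for any `ℤ`-order `O`
  with a matrix model `O₍ₚ₎ = Φ⁻¹(M₂(ℤ_p))`.

These feed the local factors at the primes `p ∤ N⁻` of Eichler's mass formula
(`brandtModule_massFormula`).

## References

* M.-F. Vignéras, *Arithmétique des algèbres de quaternions*, LNM 800 (1980), Ch. II §2
  Lemme 2.1, Thm. 2.3; Ch. I §4 Lemme 4.7; Ch. III §5 Prop. 5.1 [VignerasLNM800].
* J. Voight, *Quaternion Algebras*, GTM 288 (2021), Cor. 10.5.4, Lemma 15.6.15.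
-/

noncomputable section

open scoped TensorProduct Pointwise Matrix
open NumberField IsDedekindDomain Polynomial

universe u

namespace Literature.NumberTheory.Automorphic

/-! ### Conjugating an algebra map by a unit -/

section Conj

variable {R : Type*} [CommSemiring R] {A : Type*} [Semiring A] [Algebra R A]
  {C : Type*} [Ring C] [Algebra R C]

/-- The conjugate `x ↦ u⁻¹ φ(x) u` of an algebra map `φ : A → C` by a unit `u` of `C`.
[folklore] -/
def AlgHom.conjUnit (φ : A →ₐ[R] C) (u : Cˣ) : A →ₐ[R] C where
  toFun x := (↑u⁻¹ : C) * φ x * u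
  map_one' := by rw [map_one, mul_one, Units.inv_mul]
  map_mul' x y := by
    rw [map_mul]
    simp only [mul_assoc, Units.mul_inv_cancel_left]
  map_zero' := by rw [map_zero, mul_zero, zero_mul]
  map_add' x y := by rw [map_add, mul_add, add_mul]
  commutes' r := by
    rw [AlgHom.commutes, ← Algebra.commutes, mul_assoc, Units.inv_mul, mul_one]

/-- `AlgHom.conjUnit φ u x = u⁻¹ φ(x) u` (definitional). [folklore] -/
@[simp] theorem AlgHom.conjUnit_apply (φ : A →ₐ[R] C) (u : Cˣ) (x : A) :
    AlgHom.conjUnit φ u x = (↑u⁻¹ : C) * φ x * u := rfl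

end Conj

/-! ### `p`-adic bookkeeping -/

section PadicHelpers

variable {p : ℕ} [hp : Fact p.Prime]

/-- A natural number prime to `p` has `p`-adic norm `1`. [folklore] -/
theorem Padic.norm_natCast_eq_one_of_coprime {m : ℕ} (hm : m.Coprime p) : ‖(m : ℚ_[p])‖ = 1 := by
  have h1 : ‖((m : ℤ) : ℚ_[p])‖ ≤ 1 := Padic.norm_int_le_one (m : ℤ)
  have h2 : ¬ ‖((m : ℤ) : ℚ_[p])‖ < 1 := by
    rw [Padic.norm_intCast_lt_one_iff, Int.natCast_dvd_natCast]
    exact fun h => hp.out.one_lt.ne' (Nat.Coprime.eq_one_of_dvd hm.symm h)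
  push_cast at h1 h2
  exact le_antisymm h1 (not_lt.mp h2)

/-- The trace of a product of `p`-integral `2 × 2` matrices is `p`-integral. [folklore] -/
theorem Padic.norm_trace_mul_le_one {M N : Matrix (Fin 2) (Fin 2) ℚ_[p]}
    (hM : ∀ i j, ‖M i j‖ ≤ 1) (hN : ∀ i j, ‖N i j‖ ≤ 1) : ‖(M * N).trace‖ ≤ 1 := by
  rw [Matrix.trace_fin_two]
  exact (Padic.nonarchimedean _ _).trans
    (max_le (Padic.norm_mul_apply_le_one hM hN 0 0) (Padic.norm_mul_apply_le_one hM hN 1 1))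

/-- `tr(A E_{ji}) = A_{ij}` for `2 × 2` matrices. [folklore] -/
theorem Matrix.trace_mul_single_fin_two {R : Type*} [CommRing R] (A : Matrix (Fin 2) (Fin 2) R)
    (i j : Fin 2) : (A * Matrix.single j i (1 : R)).trace = A i j := by
  rw [Matrix.trace_fin_two]
  fin_cases i <;> fin_cases j <;>
    simp [Matrix.mul_apply, Matrix.single_apply]

end PadicHelpers

/-! ### Norms and traces through a matrix model -/

section DetTrace

variable {B : Type u} [Ring B] [Algebra ℚ B] [IsQuaternionAlgebra ℚ B]
  {K : Type*} [Field K] [Algebra ℚ K]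

/-- **`tr Φ(x) = trd x` and `det Φ(x) = nrd x` for any `ℚ`-algebra map `Φ : B → M₂(K)`**
(`K ⊇ ℚ` a field): `Φ(x)` is killed by the reduced characteristic polynomial
`X² - trd(x) X + nrd(x)` and by its own characteristic polynomial; if `Φ(x)` is not scalar the
two agree, and if `Φ(x)` is scalar then `x` is central, `x = q ∈ ℚ`, `trd x = 2q`, `nrd x = q²`.
[cite: VignerasLNM800, Ch. I §1 Lemme 1.1 and Ch. II §2] -/
theorem AlgHom.trace_eq_reducedTrace_and_det_eq_reducedNorm
    (Φ : B →ₐ[ℚ] Matrix (Fin 2) (Fin 2) K) (x : B) :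
    (Φ x).trace = algebraMap ℚ K (reducedTrace ℚ B x) ∧
      (Φ x).det = algebraMap ℚ K (reducedNorm ℚ B x) := by
  haveI := IsQuaternionAlgebra.isSimpleRing' ℚ B
  have hinj : Function.Injective Φ := RingHom.injective Φ.toRingHom
  set M := Φ x with hM
  set t : ℚ := reducedTrace ℚ B x
  set n : ℚ := reducedNorm ℚ B x
  -- the two quadratic relations
  have hsc : ∀ q : ℚ, algebraMap ℚ (Matrix (Fin 2) (Fin 2) K) q = (algebraMap ℚ K q) • (1 : Matrix _ _ K) :=
    fun q => by rw [IsScalarTower.algebraMap_apply ℚ K, Algebra.algebraMap_eq_smul_one]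
  have h1 : M * M = (algebraMap ℚ K t) • M - (algebraMap ℚ K n) • (1 : Matrix _ _ K) := by
    have h := congrArg Φ (mul_self_eq_reducedTrace_mul_sub_reducedNorm ℚ B x)
    rw [map_mul, map_sub, map_mul, AlgHom.commutes, AlgHom.commutes, hsc, hsc, smul_mul_assoc,
      one_mul] at h
    exact h
  have h2 : M * M = M.trace • M - M.det • (1 : Matrix _ _ K) := by
    have h := Matrix.aeval_self_charpoly M
    simp only [Matrix.charpoly_fin_two, map_add, map_sub, map_mul, aeval_C, aeval_X, aeval_X_pow,
      Algebra.algebraMap_eq_smul_one, smul_mul_assoc, one_mul] at h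
    rw [sq] at h
    -- h : M * M - tr • M + det • 1 = 0
    rw [← sub_eq_zero, ← h]
    abel
  have hkey : (M.trace - algebraMap ℚ K t) • M = (M.det - algebraMap ℚ K n) • (1 : Matrix _ _ K) := by
    have e := h1.symm.trans h2
    -- e : t•M - n•1 = tr•M - det•1
    rw [sub_eq_sub_iff_add_eq_add] at e
    -- e : t•M + det•1 = tr•M + n•1
    rw [sub_smul, sub_smul, sub_eq_sub_iff_add_eq_add, ← e, add_comm]
  -- the trace
  have htr : M.trace = algebraMap ℚ K t := by
    by_contra hne
    have hne' : M.trace - algebraMap ℚ K t ≠ 0 := sub_ne_zero.mpr hne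
    set c : K := (M.trace - algebraMap ℚ K t)⁻¹ * (M.det - algebraMap ℚ K n) with hc
    have hMc : M = c • (1 : Matrix _ _ K) := by
      have := congrArg (fun A => (M.trace - algebraMap ℚ K t)⁻¹ • A) hkey
      simp only [smul_smul, inv_mul_cancel₀ hne', one_smul] at this
      rw [this, hc]
    -- `x` is central
    have hcen : x ∈ Subalgebra.center ℚ B := by
      rw [Subalgebra.mem_center_iff]
      intro y
      apply hinj
      rw [map_mul, map_mul, ← hM, hMc, smul_mul_assoc, one_mul, mul_smul_comm, mul_one]
    rw [Algebra.IsCentral.center_eq_bot ℚ B, Algebra.mem_bot] at hcen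
    obtain ⟨q, hq⟩ := hcen
    apply hne
    have hMq : M = algebraMap ℚ K q • (1 : Matrix _ _ K) := by rw [hM, ← hq, AlgHom.commutes, hsc]
    rw [hMq, Matrix.trace_smul, Matrix.trace_one, Fintype.card_fin, show t = 2 * q by
      rw [show t = reducedTrace ℚ B x from rfl, ← hq, reducedTrace_algebraMap_rat], map_mul]
    simp [mul_comm]
  refine ⟨htr, ?_⟩
  rw [htr, sub_self, zero_smul] at hkey
  have h00 := congr_fun (congr_fun hkey 0) 0
  simp only [Matrix.zero_apply, Matrix.smul_apply, Matrix.one_apply_eq, smul_eq_mul, mul_one] at h00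
  exact (sub_eq_zero.mp h00.symm)

/-- `tr Φ(x) = trd x`. [cite: VignerasLNM800, Ch. I §1 Lemme 1.1 and Ch. II §2] -/
theorem AlgHom.trace_eq_reducedTrace (Φ : B →ₐ[ℚ] Matrix (Fin 2) (Fin 2) K) (x : B) :
    (Φ x).trace = algebraMap ℚ K (reducedTrace ℚ B x) :=
  (AlgHom.trace_eq_reducedTrace_and_det_eq_reducedNorm Φ x).1

/-- `det Φ(x) = nrd x`. [cite: VignerasLNM800, Ch. I §1 Lemme 1.1 and Ch. II §2] -/
theorem AlgHom.det_eq_reducedNorm (Φ : B →ₐ[ℚ] Matrix (Fin 2) (Fin 2) K) (x : B) :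
    (Φ x).det = algebraMap ℚ K (reducedNorm ℚ B x) :=
  (AlgHom.trace_eq_reducedTrace_and_det_eq_reducedNorm Φ x).2

end DetTrace

/-! ### Density of `Φ(B)` in `M₂(ℚ_p)` -/

section Density

variable {B : Type u} [Ring B] [Algebra ℚ B] [IsQuaternionAlgebra ℚ B] {p : ℕ} [hp : Fact p.Prime]

/-- **`Φ(B)` is dense in `M₂(ℚ_p)`** for any `ℚ`-algebra map `Φ : B → M₂(ℚ_p)`: the induced
`ℚ_p`-algebra map `ℚ_p ⊗ B → M₂(ℚ_p)` is injective (`ℚ_p ⊗ B` is simple) hence bijective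
(dimension `4`), so the `Φ(b_l)` (`b_l` a `ℚ`-basis of `B`) form a `ℚ_p`-basis of `M₂(ℚ_p)`,
and `ℚ` is dense in `ℚ_p`. [folklore] -/
theorem AlgHom.exists_norm_sub_le (Φ : B →ₐ[ℚ] Matrix (Fin 2) (Fin 2) ℚ_[p])
    (M : Matrix (Fin 2) (Fin 2) ℚ_[p]) (k : ℕ) :
    ∃ b : B, ∀ i j, ‖(Φ b - M) i j‖ ≤ (p : ℝ) ^ (-(k : ℤ)) := by
  classical
  have hpp : p.Prime := hp.out
  -- the induced map `ψ : ℚ_p ⊗ B → M₂(ℚ_p)`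
  let ψ : ℚ_[p] ⊗[ℚ] B →ₐ[ℚ_[p]] Matrix (Fin 2) (Fin 2) ℚ_[p] :=
    Algebra.TensorProduct.lift (Algebra.ofId ℚ_[p] _) Φ (fun a b => Algebra.commutes a (Φ b))
  have hψ : ∀ (c : ℚ_[p]) (b : B), ψ (c ⊗ₜ b) = c • Φ b := fun c b => by
    rw [Algebra.TensorProduct.lift_tmul, Algebra.ofId_apply, Algebra.smul_def]
  haveI : IsQuaternionAlgebra ℚ_[p] (ScalarExtension ℚ ℚ_[p] B) :=
    isQuaternionAlgebra_scalarExtension ℚ B ℚ_[p]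
  haveI : IsSimpleRing (ℚ_[p] ⊗[ℚ] B) := IsQuaternionAlgebra.isSimpleRing' ℚ_[p] (ScalarExtension ℚ ℚ_[p] B)
  have hinj : Function.Injective ψ := RingHom.injective ψ.toRingHom
  have hdim : Module.finrank ℚ_[p] (ℚ_[p] ⊗[ℚ] B) =
      Module.finrank ℚ_[p] (Matrix (Fin 2) (Fin 2) ℚ_[p]) := by
    rw [Module.finrank_baseChange, IsQuaternionAlgebra.finrank_eq_four (K := ℚ) (D := B),
      Module.finrank_matrix]
    simp
  have hbij : Function.Bijective ψ :=
    ⟨hinj, (LinearMap.injective_iff_surjective_of_finrank_eq_finrank hdim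
      (f := ψ.toLinearMap)).mp hinj⟩
  let eψ : ℚ_[p] ⊗[ℚ] B ≃ₗ[ℚ_[p]] Matrix (Fin 2) (Fin 2) ℚ_[p] :=
    LinearEquiv.ofBijective ψ.toLinearMap hbij
  -- bases
  let bQ := Module.finBasis ℚ B
  let bT := Algebra.TensorProduct.basis ℚ_[p] bQ
  let bE : Module.Basis _ ℚ_[p] (Matrix (Fin 2) (Fin 2) ℚ_[p]) := bT.map eψ
  have hbE : ∀ l, bE l = Φ (bQ l) := fun l => by
    simp only [bE, Module.Basis.map_apply, bT, Algebra.TensorProduct.basis_apply]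
    change ψ (1 ⊗ₜ bQ l) = Φ (bQ l)
    rw [hψ, one_smul]
  -- a common bound `p^C` for the denominators of the entries of the `bE l`
  obtain ⟨C, hC⟩ : ∃ C : ℕ, ∀ l i j, ‖bE l i j * (p : ℚ_[p]) ^ C‖ ≤ 1 := by
    have h := fun t : Fin (Module.finrank ℚ B) × Fin 2 × Fin 2 =>
      Padic.exists_norm_mul_pow_le_one (bE t.1 t.2.1 t.2.2)
    choose c hc using h
    exact ⟨Finset.univ.sup c, fun l i j =>
      Padic.norm_mul_pow_le_one_of_le (hc (l, i, j)) (Finset.le_sup (Finset.mem_univ _))⟩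
  -- approximate the coordinates of `M`
  set δ : ℝ := (p : ℝ) ^ (-((k + C : ℕ) : ℤ)) with hδ
  have hp1 : (1 : ℝ) < p := by exact_mod_cast hpp.one_lt
  have hp0 : (0 : ℝ) < p := by linarith
  have hδ0 : 0 < δ := zpow_pos hp0 _
  have happrox : ∀ l, ∃ r : ℚ, ‖bE.repr M l - r‖ < δ := fun l => Padic.rat_dense p _ hδ0
  choose r hr using happrox
  refine ⟨∑ l, r l • bQ l, fun i j => ?_⟩
  have hΦb : Φ (∑ l, r l • bQ l) = ∑ l, ((r l : ℚ) : ℚ_[p]) • bE l := by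
    rw [map_sum]
    refine Finset.sum_congr rfl fun l _ => ?_
    rw [map_smul, hbE, ← IsScalarTower.algebraMap_smul ℚ_[p] (r l) (Φ (bQ l))]
    rfl
  have hMsum : M = ∑ l, bE.repr M l • bE l := (bE.sum_repr M).symm
  have hdiff : Φ (∑ l, r l • bQ l) - M = ∑ l, (((r l : ℚ) : ℚ_[p]) - bE.repr M l) • bE l := by
    rw [hΦb]
    conv_lhs => rw [hMsum]
    rw [← Finset.sum_sub_distrib]
    refine Finset.sum_congr rfl fun l _ => ?_
    rw [sub_smul]
  rw [hdiff]
  simp only [Matrix.sum_apply, Matrix.smul_apply, smul_eq_mul]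
  refine IsUltrametricDist.norm_sum_le_of_forall_le_of_nonneg (zpow_nonneg hp0.le _)
    fun l _ => ?_
  rw [norm_mul]
  -- `‖r - c‖ < p^{-(k+C)}` and `‖bE l i j‖ ≤ p^C`
  have h1 : ‖((r l : ℚ) : ℚ_[p]) - bE.repr M l‖ < δ := by rw [norm_sub_rev]; exact hr l
  have h2 : ‖bE l i j‖ ≤ (p : ℝ) ^ (C : ℤ) := by
    have h := hC l i j
    rw [norm_mul, norm_pow, Padic.norm_p, inv_pow] at h
    have hpC : (0 : ℝ) < (p : ℝ) ^ C := pow_pos hp0 C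
    rw [mul_inv_le_iff₀ hpC, one_mul] at h
    exact_mod_cast h
  calc ‖((r l : ℚ) : ℚ_[p]) - bE.repr M l‖ * ‖bE l i j‖ ≤ δ * (p : ℝ) ^ (C : ℤ) :=
        mul_le_mul h1.le h2 (norm_nonneg _) hδ0.le
    _ = (p : ℝ) ^ (-(k : ℤ)) := by
        rw [hδ, ← zpow_add₀ hp0.ne']
        congr 1
        push_cast
        ring

end Density

/-! ### The maximal orders at a split prime -/

section SplitMaximal

variable {B : Type u} [Ring B] [Algebra ℚ B] [IsQuaternionAlgebra ℚ B] {p : ℕ} [hp : Fact p.Prime]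

omit [IsQuaternionAlgebra ℚ B] in
/-- The elements of `B` mapped to `p`-integral matrices by an algebra map `Φ : B → M₂(ℚ_p)`
form a subring. [folklore] -/
theorem exists_subring_coe_eq_integral (Φ : B →ₐ[ℚ] Matrix (Fin 2) (Fin 2) ℚ_[p]) :
    ∃ S : Subring B, (S : Set B) = {x | ∀ i j, ‖Φ x i j‖ ≤ 1} := by
  refine ⟨{ carrier := {x | ∀ i j, ‖Φ x i j‖ ≤ 1}
            mul_mem' := fun {a b} ha hb i j => by
              change ‖Φ (a * b) i j‖ ≤ 1
              rw [map_mul]; exact Padic.norm_mul_apply_le_one ha hb i j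
            one_mem' := fun i j => by
              change ‖Φ 1 i j‖ ≤ 1
              rw [map_one, Matrix.one_apply]
              split_ifs <;> simp
            add_mem' := fun {a b} ha hb i j => by
              change ‖Φ (a + b) i j‖ ≤ 1
              rw [map_add, Matrix.add_apply]
              exact (Padic.nonarchimedean _ _).trans (max_le (ha i j) (hb i j))
            zero_mem' := fun i j => by
              change ‖Φ 0 i j‖ ≤ 1
              rw [map_zero, Matrix.zero_apply, norm_zero]; exact zero_le_one
            neg_mem' := fun {a} ha i j => by
              change ‖Φ (-a) i j‖ ≤ 1
              rw [map_neg, Matrix.neg_apply, norm_neg]; exact ha i j }, rfl⟩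

omit [IsQuaternionAlgebra ℚ B] in
/-- If `m x ∈ S` for an integer `m` prime to `p`, where `S = Φ⁻¹(M₂(ℤ_p))`, then `x ∈ S`. [folklore] -/
theorem integral_of_smul_integral (Φ : B →ₐ[ℚ] Matrix (Fin 2) (Fin 2) ℚ_[p]) {x : B} {m : ℕ}
    (hm : m.Coprime p) (h : ∀ i j, ‖Φ ((m : ℤ) • x) i j‖ ≤ 1) : ∀ i j, ‖Φ x i j‖ ≤ 1 := by
  intro i j
  have h1 := h i j
  rw [map_zsmul, Matrix.smul_apply, zsmul_eq_mul, norm_mul, Int.cast_natCast,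
    Padic.norm_natCast_eq_one_of_coprime hm, one_mul] at h1
  exact h1

/-- **The maximal orders at a split prime** (Vignéras II §2 Lemme 2.1 (1), Thm. 2.3 (1), with
III §5 Prop. 5.1): for a `ℚ`-algebra map `φ : B → M₂(ℚ_p)` (`B` a division quaternion algebra
over `ℚ`) and a maximal `ℤ`-order `O₁` of `B` there is `g ∈ GL₂(ℚ_p)` with
`O₁,₍ₚ₎ = {x | g⁻¹ φ(x) g ∈ M₂(ℤ_p)}`. Proof: `g` with `g⁻¹ φ(O₁) g ⊆ M₂(ℤ_p)` is the tree's
`exists_isUnit_conj_integral`; the preimage `S` of `M₂(ℤ_p)` under `Φ = g⁻¹ φ g` is a subring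
containing `O₁,₍ₚ₎` whose elements pair `p`-integrally with `O₁` under `trd = tr ∘ Φ`, hence
`S = O₁,₍ₚ₎` (`IsMaximalZOrder.coe_eq_localAt_of_reducedTrace`). [cite: VignerasLNM800, Ch. II §2 Lemme 2.1 (1), Thm. 2.3 (1), Ch. III §5 Prop. 5.1] -/
theorem IsMaximalZOrder.exists_conjUnit_localAt_iff (hdiv : ∀ x : B, x ≠ 0 → IsUnit x)
    {O₁ : Submodule ℤ B} (hO₁ : IsMaximalZOrder O₁) (φ : B →ₐ[ℚ] Matrix (Fin 2) (Fin 2) ℚ_[p]) :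
    ∃ u : (Matrix (Fin 2) (Fin 2) ℚ_[p])ˣ,
      ∀ x : B, x ∈ localAt p O₁ ↔ ∀ i j, ‖(AlgHom.conjUnit φ u) x i j‖ ≤ 1 := by
  have hpp : p.Prime := hp.out
  obtain ⟨g, hgu, hg⟩ :=
    exists_isUnit_conj_integral φ hO₁.1.one_mem hO₁.1.mul_mem hO₁.1.isFullLattice.1
  refine ⟨hgu.unit, ?_⟩
  set Φ := AlgHom.conjUnit φ hgu.unit with hΦ
  have hΦapp : ∀ x, Φ x = g⁻¹ * φ x * g := fun x => by
    rw [hΦ, AlgHom.conjUnit_apply, IsUnit.unit_spec]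
    congr 1
    rw [show ((hgu.unit⁻¹ : (Matrix (Fin 2) (Fin 2) ℚ_[p])ˣ) : Matrix (Fin 2) (Fin 2) ℚ_[p]) = g⁻¹ from
      by rw [Matrix.coe_units_inv, IsUnit.unit_spec]]
  obtain ⟨S, hS⟩ := exists_subring_coe_eq_integral Φ
  have hmemS : ∀ x, x ∈ S ↔ ∀ i j, ‖Φ x i j‖ ≤ 1 := fun x => by
    rw [← SetLike.mem_coe, hS]; rfl
  have hO₁S : ∀ x ∈ O₁, x ∈ S := fun x hx => by
    rw [hmemS]
    intro i j
    rw [hΦapp]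
    exact hg x hx i j
  have hle : (localAt p O₁ : Set B) ⊆ S := by
    intro x hx
    obtain ⟨m, hm0, hm, hmx⟩ := hx
    rw [SetLike.mem_coe, hmemS]
    exact integral_of_smul_integral Φ hm ((hmemS _).mp (hO₁S _ hmx))
  have htr : ∀ x ∈ S, ∀ y ∈ O₁, ¬ p ∣ (reducedTrace ℚ B (x * y)).den := by
    intro x hx y hy
    rw [← Padic.norm_ratCast_le_one_iff]
    have h := AlgHom.trace_eq_reducedTrace Φ (x * y)
    rw [show algebraMap ℚ ℚ_[p] (reducedTrace ℚ B (x * y)) = ((reducedTrace ℚ B (x * y) : ℚ) : ℚ_[p])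
      from rfl] at h
    rw [← h, map_mul]
    exact Padic.norm_trace_mul_le_one ((hmemS x).mp hx) ((hmemS y).mp (hO₁S y hy))
  have hmain := hO₁.coe_eq_localAt_of_reducedTrace hdiv hpp S hle htr
  intro x
  rw [← SetLike.mem_coe, ← hmain, SetLike.mem_coe, hmemS]

omit [IsQuaternionAlgebra ℚ B] in
/-- At a split prime (for an Eichler-package-type ramification hypothesis: at `p ∤ N⁻`) there is a
matrix model: a `ℚ`-algebra map `B → M₂(ℚ_[p])`. [cite: VignerasLNM800, Ch. II §2 and Ch. III §3] -/
theorem exists_algHom_matrix_of_not_dvd {Nminus : ℕ}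
    (hram : ∀ v : HeightOneSpectrum (𝓞 ℚ), v ∈ ramifiedPlaces ℚ B ↔ ((Nminus : ℕ) : 𝓞 ℚ) ∈ v.asIdeal)
    (hpN : ¬ p ∣ Nminus) : Nonempty (B →ₐ[ℚ] Matrix (Fin 2) (Fin 2) ℚ_[p]) := by
  have hpp : p.Prime := hp.out
  set v : HeightOneSpectrum (𝓞 ℚ) := (Rat.HeightOneSpectrum.primesEquiv (R := 𝓞 ℚ)).symm ⟨p, hpp⟩
    with hv
  have hvp : ((Rat.HeightOneSpectrum.primesEquiv v : Nat.Primes) : ℕ) = p := by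
    rw [hv, Equiv.apply_symm_apply]
  have hsplit : IsSplitAt B v := by
    by_contra hns
    have h : v ∈ ramifiedPlaces ℚ B := hns
    rw [hram, ← primesEquiv_dvd_iff, hvp] at h
    exact hpN h
  obtain ⟨E⟩ := nonempty_algEquiv_padic_of_isSplitAt B v hsplit p hvp
  exact ⟨(E.restrictScalars ℚ).toAlgHom.comp Algebra.TensorProduct.includeRight⟩

end SplitMaximal

/-! ### Self-duality of the local order at a split prime -/

section SelfDual

variable {B : Type u} [Ring B] [Algebra ℚ B] [IsQuaternionAlgebra ℚ B] {p : ℕ} [hp : Fact p.Prime]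

/-- **`O₍ₚ₎` is self-dual for the trace form at a split prime**: if `O₍ₚ₎ = Φ⁻¹(M₂(ℤ_p))` for a
matrix model `Φ`, then `trd(x y) ∈ ℤ₍ₚ₎` for all `y ∈ O₍ₚ₎` iff `x ∈ O₍ₚ₎` (⇒: for an entry
`Φ(x)_{ij}` of maximal norm `t > 1`, a `y ∈ O₍ₚ₎` with `Φ(y) ≡ E_{ji} (mod p)` — density — has
`trd(x y) = tr(Φ(x) Φ(y)) = Φ(x)_{ij} + O(t/p)` of norm `t`). This is `M₂(ℤ_p)♯ = M₂(ℤ_p)`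
(Vignéras II §2 / I §4 Lemme 4.7: the different of `M₂(R)` is `R`). [cite: VignerasLNM800, Ch. I §4 Lemme 4.7, Ch. II §2] -/
theorem forall_not_dvd_den_reducedTrace_iff_of_split (Φ : B →ₐ[ℚ] Matrix (Fin 2) (Fin 2) ℚ_[p])
    {O : Submodule ℤ B} (hO : IsZOrder O) (hΛ : ∀ x : B, x ∈ localAt p O ↔ ∀ i j, ‖Φ x i j‖ ≤ 1)
    (x : B) : (∀ y ∈ localAt p O, ¬ p ∣ (reducedTrace ℚ B (x * y)).den) ↔ x ∈ localAt p O := by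
  classical
  have hpp : p.Prime := hp.out
  refine ⟨fun h => ?_, fun hx y hy => hO.not_dvd_den_reducedTrace_of_mem_localAt (hO.mul_mem_localAt hx hy)⟩
  rw [hΛ]
  by_contra hbad
  push Not at hbad
  -- an entry of maximal norm `t > 1`
  obtain ⟨⟨i₀, j₀⟩, -, hmax⟩ := Finset.exists_max_image (Finset.univ : Finset (Fin 2 × Fin 2))
    (fun ij => ‖Φ x ij.1 ij.2‖) ⟨⟨0, 0⟩, Finset.mem_univ _⟩
  set t : ℝ := ‖Φ x i₀ j₀‖ with ht
  have hle : ∀ i j, ‖Φ x i j‖ ≤ t := fun i j => hmax ⟨i, j⟩ (Finset.mem_univ _)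
  have ht1 : 1 < t := by
    obtain ⟨i, j, hij⟩ := hbad
    exact lt_of_lt_of_le hij (hle i j)
  have ht0 : 0 < t := by linarith
  -- `y` with `Φ y ≡ E_{j₀ i₀}` modulo `p`
  obtain ⟨y, hy⟩ := AlgHom.exists_norm_sub_le Φ (Matrix.single j₀ i₀ (1 : ℚ_[p])) 1
  have hp1 : (1 : ℝ) < p := by exact_mod_cast hpp.one_lt
  have hp0 : (0 : ℝ) < p := by linarith
  have hpinv : (p : ℝ) ^ (-((1 : ℕ) : ℤ)) < 1 := zpow_lt_one_of_neg₀ hp1 (by norm_num)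
  set Δ := Φ y - Matrix.single j₀ i₀ (1 : ℚ_[p]) with hΔ
  have hΔle : ∀ i j, ‖Δ i j‖ ≤ (p : ℝ) ^ (-((1 : ℕ) : ℤ)) := hy
  have hΔlt : ∀ i j, ‖Δ i j‖ < 1 := fun i j => lt_of_le_of_lt (hΔle i j) hpinv
  -- `Φ y` is integral, so `y ∈ O₍ₚ₎`
  have hyint : ∀ i j, ‖Φ y i j‖ ≤ 1 := by
    intro i j
    have : Φ y i j = Matrix.single j₀ i₀ (1 : ℚ_[p]) i j + Δ i j := by
      rw [hΔ, Matrix.sub_apply]; ring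
    rw [this]
    refine (Padic.nonarchimedean _ _).trans (max_le ?_ (hΔlt i j).le)
    rw [Matrix.single_apply]
    split_ifs <;> simp
  have hyΛ : y ∈ localAt p O := (hΛ y).mpr hyint
  -- `trd(x y) = Φ(x)_{i₀ j₀} + tr(Φ(x) Δ)`
  have htr : ((reducedTrace ℚ B (x * y) : ℚ) : ℚ_[p]) = Φ x i₀ j₀ + (Φ x * Δ).trace := by
    have h := AlgHom.trace_eq_reducedTrace Φ (x * y)
    rw [show algebraMap ℚ ℚ_[p] (reducedTrace ℚ B (x * y)) = ((reducedTrace ℚ B (x * y) : ℚ) : ℚ_[p])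
      from rfl] at h
    rw [← h, map_mul, show Φ y = Matrix.single j₀ i₀ (1 : ℚ_[p]) + Δ by rw [hΔ]; abel, mul_add,
      Matrix.trace_add, Matrix.trace_mul_single_fin_two]
  -- the error term has norm `< t`
  have herr : ‖(Φ x * Δ).trace‖ < t := by
    rw [Matrix.trace_fin_two]
    have hentry : ∀ i, ‖(Φ x * Δ) i i‖ < t := by
      intro i
      rw [Matrix.mul_apply, Fin.sum_univ_two]
      refine lt_of_le_of_lt (Padic.nonarchimedean _ _) (max_lt ?_ ?_) <;>
      · rw [norm_mul]
        calc ‖Φ x i _‖ * ‖Δ _ i‖ ≤ t * ‖Δ _ i‖ := mul_le_mul_of_nonneg_right (hle _ _) (norm_nonneg _)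
          _ < t * 1 := (mul_lt_mul_of_pos_left (hΔlt _ _) ht0)
          _ = t := mul_one t
    exact lt_of_le_of_lt (Padic.nonarchimedean _ _) (max_lt (hentry 0) (hentry 1))
  have hnorm : ‖((reducedTrace ℚ B (x * y) : ℚ) : ℚ_[p])‖ = t := by
    rw [htr, Padic.add_eq_max_of_ne (by rw [← ht]; exact herr.ne'), ← ht]
    exact max_eq_left herr.le
  have hint : ‖((reducedTrace ℚ B (x * y) : ℚ) : ℚ_[p])‖ ≤ 1 :=
    Padic.norm_ratCast_le_one_iff.mpr (h y hyΛ)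
  linarith

end SelfDual

end Literature.NumberTheory.Automorphic
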